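/-
Literature/Probability/FitznerVanDerHofstad2017/SrwCountZipKernel.lean   (NEW, additive, d-generic)

Deep kernel rows of the simple-random-walk end-point counts: the binomial dimension recursion of
`SrwLawKernelCount` evaluated SEQUENTIALLY (zipped Pascal rows, zipped reflected one-dimensional rows, a
reversed prefix of the previous level) so that the Lean kernel computes a whole row `[c_0(x), …, c_L(x)]` at
depths `L` of one to two hundred in `O(d · L²)` list steps on integers of the natural size `(2d)^L`, with no
indexing and no factorial scaling.
-/
import Literature.Probability.FitznerVanDerHofstad2017.SrwCountEgfKernel
import Literature.Probability.FitznerVanDerHofstad2017.SrwOrbitPatternLaw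
import HarnessLib

/-!
# Deep kernel rows of the SRW end-point counts (the dimension recursion, zipped)

Companion of `SrwLawKernelCount` (the row form `SrwCount.srwCountRow L A x`, one binomial convolution level per
coordinate, each entry an indexed sum) and of `SrwCountEgfKernel` (the Kronecker-packed EGF product
`srwCountRowFast d L cs`).  Both serve the table-range cuts (`L ≤ 30`) in fractions of a second; for the DEEP law
rows wanted by positional far-node certificates (the origin-law tail `Σ_{l ≤ i < L} p_i(x)` at `L` well beyond one
hundred, [NoBLE17-I] (5.14) p. 1092) the first costs about a minute of kernel time per point at `L = 140`,
`d = 10` (indexed access, the one-dimensional table recomputed per level) and the second exhausts the default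
heartbeat budget near `L = 100` (its per-coordinate EGF lists are built from the indexed one-dimensional table,
and the packed integers reach millions of digits).  This module evaluates the SAME recursion

  `G x (j+1) m = Σ_{a ≤ m} C(m,a) · walk1(a, x_j) · G x j (m-a)`      (`SrwCount.G_succ`)

([NoBLE17-I] §5.1.1 (5.4)–(5.5): the step law is the uniform mixture of the `2d` coordinate moves, so the
`m`-step count is the multinomial convolution of the one-dimensional counts) with every ingredient produced by a
ZIP of two lists — the Pascal row `[C(m,0), …, C(m,m)]` from the previous one, the reflected one-dimensional row
`[walk1(a,0), walk1(a,1), …]` from the previous one, and the sum over `a` as the scalar product of the Pascal row,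
the column `[walk1(0,c), …, walk1(L,c)]` and the reversed prefix `[G_m, …, G_0]` — each level forced once
(`seqListNat`).

* `srwCountRowZip d L cs` — the row `[c_0(x), …, c_L(x)]` of the point with coordinate-magnitude list `cs`
  (padded by zeros to `d` coordinates);
* **`srwCountRowZip_getD`**: entry `m ≤ L` is `srwCount d m x` whenever `|x_j| = cs_j` (`0` beyond the list) and
  `|cs| ≤ d` — the same hypotheses as `srwCountRowFast_getD`.

Measured on the build farm (kernel-cost census only; `decide +kernel`, `d = 10`, profile `(4,3,1)`, seven
tail cuts read off the forced row): about `18 s` at `L = 140` and `45 s` at `L = 200`.  Every statement is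
`d`-generic; no numeral of any record enters; pointer language throughout (walk counts, no statement about
percolation in any dimension).

References: [NoBLE17-I] = `FitznerVanDerHofstad2016NoBLE` (§5.1.1 (5.4)–(5.5) pp. 1089–1090, the SRW step law
and its transform; (5.14) p. 1092, the far-node tail bound that consumes deep law rows); F. Spitzer, Principles of
Random Walk, 2nd ed. (1976), §1 P1.1–P1.3 (the n-step transition function as an n-fold convolution).
-/

namespace Literature.Probability.FitznerVanDerHofstad2017

open Finset
open SrwCount (walk1 walk1_succ walk1_neg walk1_zero coordD G G_succ G_zero srwCount getD_map_range
  sum_map_range)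
open scoped BigOperators

variable {d : ℕ}

namespace SrwZip

/-! ### §1. List plumbing -/

/-- `(zipWith f l l')_i = f l_i l'_i` inside both lists. [folklore] -/
private theorem getD_zipWith_of_lt {α β γ : Type*} (f : α → β → γ) {l : List α} {l' : List β} {i : ℕ}
    (a : α) (b : β) (e : γ) (h : i < l.length) (h' : i < l'.length) :
    (List.zipWith f l l').getD i e = f (l.getD i a) (l'.getD i b) := by
  have hz : i < (List.zipWith f l l').length := by rw [List.length_zipWith]; exact lt_min h h'
  rw [List.getD_eq_getElem?_getD, List.getElem?_eq_getElem hz, Option.getD_some, List.getElem_zipWith,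
    List.getD_eq_getElem?_getD, List.getElem?_eq_getElem h, Option.getD_some,
    List.getD_eq_getElem?_getD, List.getElem?_eq_getElem h', Option.getD_some]

/-- `(l.drop m).headD 0 = l_m`. [folklore] -/
private theorem headD_drop : ∀ (l : List ℕ) (m : ℕ), (l.drop m).headD 0 = l.getD m 0
  | [], m => by simp
  | x :: t, 0 => by simp
  | x :: t, m + 1 => by rw [List.drop_succ_cons, headD_drop t m, List.getD_cons_succ]

/-- `(l.drop m).tail = l.drop (m+1)`. [folklore] -/
private theorem tail_drop' : ∀ (l : List ℕ) (m : ℕ), (l.drop m).tail = l.drop (m + 1)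
  | [], m => by simp
  | x :: t, 0 => by simp
  | x :: t, m + 1 => by rw [List.drop_succ_cons, tail_drop' t m, List.drop_succ_cons]

/-- Scalar product of a list of length `n` with a list at least as long. [folklore] -/
private theorem sum_zipWith_mul : ∀ (p q : List ℕ) (n : ℕ), p.length = n → n ≤ q.length →
    (List.zipWith (· * ·) p q).sum = ∑ a ∈ range n, p.getD a 0 * q.getD a 0
  | [], q, n, hp, _ => by
      simp only [List.length_nil] at hp
      subst hp
      simp
  | x :: p, [], n, hp, hq => by
      simp only [List.length_cons, List.length_nil] at hp hq
      omega
  | x :: p, y :: q, n, hp, hq => by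
      simp only [List.length_cons] at hp hq
      subst hp
      rw [List.zipWith_cons_cons, List.sum_cons, sum_range_succ']
      simp only [List.getD_cons_succ, List.getD_cons_zero]
      rw [sum_zipWith_mul p q p.length rfl (by omega), add_comm]

/-! ### §2. The reflected one-dimensional rows and the column `[walk1(0,c), …, walk1(L,c)]` -/

/-- One step of the reflected one-dimensional recursion as a zip (no indexing):
`n₀ = 2 r₁`, `n_y = r_{y-1} + r_{y+1}` (`y ≥ 1`, a `0` past the end). [folklore] -/
private def reflStep : List ℕ → List ℕ
  | [] => []
  | r0 :: t => (2 * t.headD 0) :: List.zipWith (· + ·) (r0 :: t) (t.tail ++ [0])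

/-- The row `[[y = 0]]_{y ≤ A}`. [folklore] -/
private def row0 (A : ℕ) : List ℕ := (List.range (A + 1)).map fun y => if y = 0 then 1 else 0

/-- Row invariant: length `A + 1` and entries `walk1 a y` for `y + a ≤ A`. [folklore] -/
private def RowOK (A a : ℕ) (r : List ℕ) : Prop :=
  r.length = A + 1 ∧ ∀ y, y + a ≤ A → r.getD y 0 = walk1 a y

/-- [folklore] -/
private theorem rowOK_row0 (A : ℕ) : RowOK A 0 (row0 A) := by
  refine ⟨by simp [row0], fun y hy => ?_⟩
  rw [row0, getD_map_range _ (by omega), walk1_zero]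
  simp

/-- [folklore] -/
private theorem rowOK_reflStep {A a : ℕ} (hA : 1 ≤ A) {r : List ℕ} (hr : RowOK A a r) :
    RowOK A (a + 1) (reflStep r) := by
  obtain ⟨hlen, hval⟩ := hr
  match r, hlen, hval with
  | [], hlen, _ => simp at hlen
  | r0 :: t, hlen, hval =>
    simp only [List.length_cons] at hlen
    have htl : t.length = A := by omega
    have htt : (t.tail ++ [0]).length = A := by
      rw [List.length_append, List.length_tail, htl, List.length_singleton]; omega
    refine ⟨?_, fun y hy => ?_⟩
    · rw [reflStep, List.length_cons, List.length_zipWith, List.length_cons, htl, htt]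
      omega
    · rw [reflStep, walk1_succ]
      cases y with
      | zero =>
          have h1 := hval 1 (by omega)
          rw [List.getD_cons_succ] at h1
          rw [List.getD_cons_zero, Nat.cast_zero, zero_sub, walk1_neg, zero_add, two_mul,
            show t.headD 0 = t.getD 0 0 by cases t <;> rfl, h1, Nat.cast_one]
      | succ y =>
          have hy0 := hval y (by omega)
          have hy2 := hval (y + 2) (by omega)
          rw [List.getD_cons_succ] at hy2
          rw [List.getD_cons_succ, getD_zipWith_of_lt (· + ·) 0 0 0 (by rw [List.length_cons]; omega)
            (by rw [htt]; omega), hy0, List.getD_append _ _ _ _ (by rw [List.length_tail]; omega),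
            List.getD_eq_getElem?_getD, List.getElem?_tail, ← List.getD_eq_getElem?_getD, hy2,
            show ((y + 1 : ℕ) : ℤ) - 1 = (y : ℤ) by push_cast; ring,
            show ((y + 1 : ℕ) : ℤ) + 1 = ((y + 2 : ℕ) : ℤ) by push_cast; ring]

/-- The column `[walk1(a₀,c)·?, …]`: `n` entries, read off successive reflected rows (forced per row). [folklore] -/
private def walk1ColGo (c : ℕ) : ℕ → List ℕ → List ℕ
  | 0, _ => []
  | n + 1, row => seqListNat row fun row' => row'.getD c 0 :: walk1ColGo c n (reflStep row')

/-- **The one-dimensional column** `walk1Col L c = [walk1 0 c, walk1 1 c, …, walk1 L c]` (reflected recursion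
run to width `c + L + 1`). [folklore] -/
private def walk1Col (L c : ℕ) : List ℕ := walk1ColGo c (L + 1) (row0 (c + L + 1))

/-- [folklore] -/
private theorem length_walk1ColGo (c : ℕ) : ∀ (n : ℕ) (row : List ℕ), (walk1ColGo c n row).length = n
  | 0, row => rfl
  | n + 1, row => by rw [walk1ColGo, seqListNat_eq, List.length_cons, length_walk1ColGo c n]

/-- [folklore] -/
private theorem walk1ColGo_getD {A : ℕ} (hA : 1 ≤ A) (c : ℕ) :
    ∀ (n a₀ : ℕ) (row : List ℕ), RowOK A a₀ row → ∀ i < n, c + a₀ + i ≤ A →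
      (walk1ColGo c n row).getD i 0 = walk1 (a₀ + i) c
  | 0, a₀, row, _, i, hi, _ => absurd hi (Nat.not_lt_zero i)
  | n + 1, a₀, row, hrow, i, hi, hci => by
      rw [walk1ColGo, seqListNat_eq]
      cases i with
      | zero => rw [List.getD_cons_zero, hrow.2 c (by omega), Nat.add_zero]
      | succ i =>
          rw [List.getD_cons_succ, walk1ColGo_getD hA c n (a₀ + 1) (reflStep row) (rowOK_reflStep hA hrow) i
            (by omega) (by omega), show a₀ + 1 + i = a₀ + (i + 1) by omega]

/-- [folklore] -/
private theorem length_walk1Col (L c : ℕ) : (walk1Col L c).length = L + 1 := length_walk1ColGo c _ _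

/-- [folklore] -/
private theorem walk1Col_getD {L c a : ℕ} (ha : a ≤ L) : (walk1Col L c).getD a 0 = walk1 a c := by
  rw [walk1Col, walk1ColGo_getD (by omega) c (L + 1) 0 (row0 (c + L + 1)) (rowOK_row0 _) a (by omega) (by omega),
    Nat.zero_add]

/-! ### §3. Pascal rows -/

/-- Next Pascal row: `[C(m+1,0), …, C(m+1,m+1)]` from `[C(m,0), …, C(m,m)]` (one zip). [folklore] -/
private def pascalStep (r : List ℕ) : List ℕ := List.zipWith (· + ·) (0 :: r) (r ++ [0])

/-- Pascal-row invariant: length `m + 1`, entries `C(m,a)` (for every `a`, `0` beyond). [folklore] -/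
private def PasOK (m : ℕ) (r : List ℕ) : Prop := r.length = m + 1 ∧ ∀ a, r.getD a 0 = m.choose a

/-- [folklore] -/
private theorem pasOK_one : PasOK 0 [1] :=
  ⟨rfl, fun a => by cases a <;> simp⟩

/-- [folklore] -/
private theorem pasOK_step {m : ℕ} {r : List ℕ} (hr : PasOK m r) : PasOK (m + 1) (pascalStep r) := by
  obtain ⟨hlen, hval⟩ := hr
  have hl2 : (r ++ [0]).length = m + 2 := by rw [List.length_append, hlen, List.length_singleton]
  have hlen' : (pascalStep r).length = m + 2 := by
    rw [pascalStep, List.length_zipWith, List.length_cons, hlen, hl2]; omega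
  refine ⟨hlen', fun a => ?_⟩
  by_cases ha : a < m + 2
  · rw [pascalStep, getD_zipWith_of_lt (· + ·) 0 0 0 (by rw [List.length_cons]; omega) (by omega)]
    cases a with
    | zero => rw [List.getD_cons_zero, List.getD_append _ _ _ _ (by omega), hval 0]; simp
    | succ a =>
        rw [List.getD_cons_succ, hval a, Nat.choose_succ_succ]
        by_cases ha' : a + 1 < m + 1
        · rw [List.getD_append _ _ _ _ (by omega), hval (a + 1)]
        · rw [List.getD_append_right _ _ _ _ (by omega), hlen, show a + 1 - (m + 1) = 0 by omega,
            List.getD_cons_zero, Nat.choose_eq_zero_of_lt (show m < a + 1 by omega)]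
  · rw [List.getD_eq_default _ _ (by omega), Nat.choose_eq_zero_of_lt (show m + 1 < a by omega)]

/-! ### §4. One level of the dimension recursion, sequentially in `m` -/

/-- One level, entries `m, m+1, …` (`n` of them): state = (Pascal row `m`, reversed prefix `[G_{m-1}, …, G_0]`,
remaining suffix `[G_m, G_{m+1}, …]`); each entry `Σ_{a ≤ m} C(m,a) · w_a · G_{m-a}` is the scalar product of
three lists and is forced before the next. [folklore] -/
private def levelGo (w : List ℕ) : ℕ → List ℕ → List ℕ → List ℕ → List ℕ
  | 0, _, _, _ => []
  | n + 1, pas, revG, rest =>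
      seqNat ((List.zipWith (· * ·) (List.zipWith (· * ·) pas w) (rest.headD 0 :: revG)).sum) fun s =>
        s :: levelGo w n (pascalStep pas) (rest.headD 0 :: revG) rest.tail

/-- **One level**: from the row `[G 0, …, G L]` of level `j` and the coordinate magnitude `c = |x_j|`, the row
`[G' 0, …, G' L]` of level `j + 1`, `G' m = Σ_{a ≤ m} C(m,a) · walk1(a,c) · G (m-a)`. [folklore] -/
private def level (L c : ℕ) (Gl : List ℕ) : List ℕ := levelGo (walk1Col L c) (L + 1) [1] [] Gl

/-- The target of one level: `S ω g m = Σ_{a ≤ m} C(m,a) · ω a · g (m-a)`. [folklore] -/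
private def S (ω g : ℕ → ℕ) (m : ℕ) : ℕ := ∑ a ∈ range (m + 1), m.choose a * (ω a * g (m - a))

/-- [folklore] -/
private theorem levelGo_getD {L : ℕ} {w : List ℕ} {ω g : ℕ → ℕ} (hwl : w.length = L + 1)
    (hw : ∀ a ≤ L, w.getD a 0 = ω a) {Gl : List ℕ} (hG : ∀ i ≤ L, Gl.getD i 0 = g i) :
    ∀ (n m : ℕ) (pas revG : List ℕ), m + n = L + 1 → PasOK m pas →
      (revG.length = m ∧ ∀ a < m, revG.getD a 0 = g (m - 1 - a)) →
      ∀ i < n, (levelGo w n pas revG (Gl.drop m)).getD i 0 = S ω g (m + i)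
  | 0, m, pas, revG, _, _, _, i, hi => absurd hi (Nat.not_lt_zero i)
  | n + 1, m, pas, revG, hmn, hpas, hrev, i, hi => by
      have hm : m ≤ L := by omega
      -- the new reversed prefix `[G_m, …, G_0]`
      have hrev' : ((Gl.drop m).headD 0 :: revG).length = m + 1 ∧
          ∀ a < m + 1, ((Gl.drop m).headD 0 :: revG).getD a 0 = g (m - a) := by
        refine ⟨by rw [List.length_cons, hrev.1], fun a ha => ?_⟩
        cases a with
        | zero => rw [List.getD_cons_zero, headD_drop, hG m hm, Nat.sub_zero]
        | succ a => rw [List.getD_cons_succ, hrev.2 a (by omega), show m - 1 - a = m - (a + 1) by omega]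
      rw [levelGo, seqNat_eq]
      cases i with
      | zero =>
          -- the head: the scalar product is the level sum at `m`
          rw [List.getD_cons_zero, Nat.add_zero, S]
          have hin : (List.zipWith (· * ·) pas w).length = m + 1 := by
            rw [List.length_zipWith, hpas.1, hwl]; omega
          rw [sum_zipWith_mul _ _ (m + 1) hin (by rw [hrev'.1])]
          refine sum_congr rfl fun a ha => ?_
          have ha' : a < m + 1 := mem_range.1 ha
          rw [getD_zipWith_of_lt (· * ·) 0 0 0 (by rw [hpas.1]; exact ha') (by rw [hwl]; omega), hpas.2 a,
            hw a (by omega), hrev'.2 a ha', mul_assoc]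
      | succ i =>
          rw [List.getD_cons_succ, tail_drop',
            levelGo_getD hwl hw hG n (m + 1) (pascalStep pas) _ (by omega) (pasOK_step hpas)
              ⟨hrev'.1, fun a ha => by rw [hrev'.2 a ha, show m + 1 - 1 - a = m - a by omega]⟩ i (by omega),
            show m + 1 + i = m + (i + 1) by omega]

/-- [folklore] -/
private theorem length_levelGo (w : List ℕ) : ∀ (n : ℕ) (pas revG rest : List ℕ),
    (levelGo w n pas revG rest).length = n
  | 0, _, _, _ => rfl
  | n + 1, pas, revG, rest => by rw [levelGo, seqNat_eq, List.length_cons, length_levelGo w n]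

/-- **One level is the binomial convolution**: for `m ≤ L`,
`(level L c Gl)_m = Σ_{a ≤ m} C(m,a) · walk1(a,c) · g(m-a)` whenever `Gl_i = g i` (`i ≤ L`). [folklore] -/
private theorem level_getD {L c : ℕ} {Gl : List ℕ} {g : ℕ → ℕ} (hG : ∀ i ≤ L, Gl.getD i 0 = g i) {m : ℕ}
    (hm : m ≤ L) : (level L c Gl).getD m 0 = S (fun a => walk1 a c) g m := by
  have h := levelGo_getD (length_walk1Col L c) (fun a ha => walk1Col_getD ha) hG (L + 1) 0 [1] []
    (by omega) pasOK_one ⟨rfl, fun a ha => absurd ha (Nat.not_lt_zero a)⟩ m (by omega)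
  rwa [List.drop_zero, Nat.zero_add] at h

/-! ### §5. All levels; the deep row -/

/-- All levels over the coordinate magnitudes `c_j, c_{j+1}, …`, forcing each level. [folklore] -/
private def levelsGo (L : ℕ) : List ℕ → List ℕ → List ℕ
  | [], Gl => Gl
  | c :: rest, Gl => seqListNat (level L c Gl) fun Gl' => levelsGo L rest Gl'

/-- [folklore] -/
private theorem levelsGo_getD {L : ℕ} {x : Fin d → ℤ} :
    ∀ (cl : List ℕ) (j : ℕ) (Gl : List ℕ), (∀ i < cl.length, (coordD x (j + i)).natAbs = cl.getD i 0) →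
      (∀ i ≤ L, Gl.getD i 0 = G x j i) → ∀ m ≤ L, (levelsGo L cl Gl).getD m 0 = G x (j + cl.length) m
  | [], j, Gl, _, hG, m, hm => by rw [levelsGo, List.length_nil, Nat.add_zero, hG m hm]
  | c :: cl, j, Gl, hcl, hG, m, hm => by
      rw [levelsGo, seqListNat_eq, List.length_cons, ← Nat.add_assoc, Nat.add_right_comm]
      refine levelsGo_getD cl (j + 1) (level L c Gl) (fun i hi => ?_) (fun i hi => ?_) m hm
      · rw [Nat.add_right_comm, Nat.add_assoc]
        simpa using hcl (i + 1) (by rw [List.length_cons]; omega)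
      · -- level `j + 1` from level `j`: `G_succ`
        have hc : (coordD x j).natAbs = c := by simpa using hcl 0 (by simp)
        have hw : ∀ a, walk1 a (coordD x j) = walk1 a (c : ℤ) := fun a => by
          rw [← hc]
          rcases Int.natAbs_eq (coordD x j) with h | h
          · exact congrArg _ h
          · conv_lhs => rw [h, walk1_neg]
        rw [level_getD hG hi, S, G_succ, Finset.Nat.sum_antidiagonal_eq_sum_range_succ_mk]
        exact sum_congr rfl fun a _ => by rw [hw a]

end SrwZip

open SrwZip

/-- **Deep kernel row of the SRW end-point counts** `[c_0(x), …, c_L(x)]` for the point `x` whose coordinates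
have magnitudes `cs` (padded by zeros to `d` coordinates; requires `|cs| ≤ d`): the binomial dimension
recursion, one zipped level per coordinate, each level forced once.
[cite: FitznerVanDerHofstad2016NoBLE, §5.1.1 (5.4)–(5.5) pp. 1089–1090 (the SRW n-step law as the n-fold convolution of the uniform step law on the 2d coordinate moves)] -/
def srwCountRowZip (d L : ℕ) (cs : List ℕ) : List ℕ :=
  SrwZip.levelsGo L (cs ++ List.replicate (d - cs.length) 0)
    ((List.range (L + 1)).map fun m => if m = 0 then 1 else 0)

/-- **Bridge**: for `m ≤ L`, `|cs| ≤ d` and a point `x` with coordinate magnitudes `|x_j| = cs_j` (`0` beyond the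
list), entry `m` of the deep row is `c_m(x) = srwCount d m x`.
[cite: FitznerVanDerHofstad2016NoBLE, §5.1.1 (5.4)–(5.5) pp. 1089–1090 (the SRW n-step law)] -/
theorem srwCountRowZip_getD {L m : ℕ} {cs : List ℕ} {x : Fin d → ℤ} (hcs : cs.length ≤ d)
    (hx : ∀ j, (coordD x j).natAbs = cs.getD j 0) (hm : m ≤ L) :
    (srwCountRowZip d L cs).getD m 0 = srwCount d m x := by
  have hlen : (cs ++ List.replicate (d - cs.length) 0).length = d := by
    rw [List.length_append, List.length_replicate]; omega
  have h := SrwZip.levelsGo_getD (L := L) (x := x) (cs ++ List.replicate (d - cs.length) 0) 0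
    ((List.range (L + 1)).map fun m => if m = 0 then 1 else 0) (fun i hi => ?_) (fun i hi => ?_) m hm
  · rwa [hlen, Nat.zero_add] at h
  · rw [Nat.zero_add, hx i]
    by_cases hic : i < cs.length
    · rw [List.getD_append _ _ _ _ hic]
    · rw [List.getD_append_right _ _ _ _ (by omega), List.getD_eq_default _ _ (by omega),
        List.getD_eq_getElem?_getD, List.getElem?_replicate]
      split_ifs <;> rfl
  · rw [getD_map_range _ (by omega), G_zero]

/-! ### §6. Sanity checks (kernel) -/

/-- On `ℤ³` at `x = (2,1,0)`, `L = 6`: the deep row is the row form of `SrwLawKernelCount`. [folklore] -/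
example : srwCountRowZip 3 6 [2, 1] = SrwCount.srwCountRow 6 9 (![2, 1, 0] : Fin 3 → ℤ) := by decide +kernel
/-- … and the fast row of `SrwCountEgfKernel` (`d = 4`, magnitudes `(3,1,1)`, `L = 9`). [folklore] -/
example : srwCountRowZip 4 9 [3, 1, 1] = srwCountRowFast 4 9 [3, 1, 1] := by decide +kernel

end Literature.Probability.FitznerVanDerHofstad2017
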